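/-
PRIME-WINDOW BLINDNESS — footprint lemmas (cell rh-split, L53; director-rh g12 (BA1)(ii); spec rh-idea-4 g3
`pub/ideators/rh-idea-4/pwb/LINE-PrimeWindowBlindness.md` §2a, termwise estimate vetted by idea-crit-1 g2
02:41:23Z §(4)).  Part 1 of 2 of the K-task K1 (`PrimeWindowBlindModel.lean` is part 2).  Typed by
rh-split-typer-3 g5.  Nothing here bears on the truth of RH.
-/
import Summits.RiemannHypothesis.RiemannHypothesis.Theorems.Splittings.ScrewLatticeTowerMaxRe
import HarnessLib

/-!
# Window footprint of a quadruple and of a configuration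

The continuum model screw function `Ψ_Z(t) = Σ_i (T_{(i,1)}(t) + T_{(i,2)}(t))` (`ScrewLatticeWolff.modelPsi`,
quadruple term `T_q(t) = 4 m Re[(cosh(κ t) - 1)/κ²]` = `ScrewLatticeWolff.quadTerm`) of a configuration of
off-line zero quadruples `{1/2 ± σ ± iγ}` is controlled on a WINDOW `|t| ≤ U` by the same series `Σ m/γ²` that
the blind models keep summable:

* `abs_quadTerm_le_window`: `|T_q(t)| ≤ 8 e^{σ* U} m/γ²` for `|σ| ≤ σ*`, `γ ≠ 0`, `|t| ≤ U` — the tree's termwise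
  majorant `ScrewLatticeTowerMaxRe.abs_quadTerm_le` (`|T_q(t)| ≤ 8 m e^{|σ| t}/γ²`, `t ≥ 0`) made even in `t` and
  monotone in the window;
* `abs_modelPsi_le_window`: `|Ψ_Z(t)| ≤ 8 e^{σ* U} Σ_i (m₁/γ₁² + m₂/γ₂²)` for `|t| ≤ U` (`tsum_of_norm_bounded`;
  no summability hypothesis on `Ψ_Z` itself);
* `footprint_budget`: the budget arithmetic of the dilation used in part 2 — with the scale `λ = 3h²/(4π²M²)`
  and `36 h² e^{σ*U} A/(π² ε) ≤ M²`, `8 e^{σ*U} · 6 λ A ≤ ε`.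

ζ-free, RH-free; std axioms.  Nothing here bears on the truth of RH.
-/

noncomputable section

set_option linter.dupNamespace false

open Complex
open scoped Real

namespace Summit.RiemannHypothesis.RiemannHypothesis.Theorems.Splittings.ScrewLatticeTower

open Summit.RiemannHypothesis.RiemannHypothesis.Theorems.Splittings.ScrewLatticeWolff

/-! ## 21. Window footprint of one quadruple and of a configuration -/

/-- Window footprint of one quadruple: for `|Re κ| ≤ σ*`, `Im κ ≠ 0`, `m ≥ 0` and `|t| ≤ U`,
`|T_q(t)| ≤ 8 e^{σ* U} · m/(Im κ)²` (`abs_quadTerm_le` at `|t|`, evenness `quadTerm_neg`). -/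
theorem abs_quadTerm_le_window {m σs U t : ℝ} {κ : ℂ} (hm : 0 ≤ m) (hre : |κ.re| ≤ σs) (him : κ.im ≠ 0)
    (ht : |t| ≤ U) : |quadTerm m κ t| ≤ 8 * Real.exp (σs * U) * (m / κ.im ^ 2) := by
  have hσs : 0 ≤ σs := (abs_nonneg _).trans hre
  have heven : quadTerm m κ t = quadTerm m κ |t| := by
    rcases le_or_gt 0 t with h0 | h0
    · rw [abs_of_nonneg h0]
    · rw [abs_of_neg h0, quadTerm_neg]
  have he : Real.exp (|κ.re| * |t|) ≤ Real.exp (σs * U) :=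
    Real.exp_le_exp.2 (mul_le_mul hre ht (abs_nonneg _) hσs)
  have hγ2 : 0 < κ.im ^ 2 := by positivity
  rw [heven]
  calc |quadTerm m κ (|t|)| ≤ 8 * m * Real.exp (|κ.re| * |t|) / κ.im ^ 2 := abs_quadTerm_le hm him (abs_nonneg t)
    _ ≤ 8 * m * Real.exp (σs * U) / κ.im ^ 2 :=
        div_le_div_of_nonneg_right (mul_le_mul_of_nonneg_left he (by positivity)) hγ2.le
    _ = 8 * Real.exp (σs * U) * (m / κ.im ^ 2) := by ring

/-- **Window footprint of a configuration.**  If both families have `m ≥ 0`, `|Re κ| ≤ σ*`, `Im κ ≠ 0` and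
`Σ_i (m₁/γ₁² + m₂/γ₂²) = K`, then `|Ψ_Z(t)| ≤ 8 e^{σ* U} K` for `|t| ≤ U` (the model screw function is
summable there, by comparison; `tsum_of_norm_bounded`). -/
theorem abs_modelPsi_le_window {ι : Type*} {m₁ m₂ : ι → ℝ} {κ₁ κ₂ : ι → ℂ} {σs U t K : ℝ}
    (hm : ∀ i, 0 ≤ m₁ i ∧ 0 ≤ m₂ i) (hre : ∀ i, |(κ₁ i).re| ≤ σs ∧ |(κ₂ i).re| ≤ σs)
    (him : ∀ i, (κ₁ i).im ≠ 0 ∧ (κ₂ i).im ≠ 0)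
    (hK : HasSum (fun i ↦ m₁ i / (κ₁ i).im ^ 2 + m₂ i / (κ₂ i).im ^ 2) K) (ht : |t| ≤ U) :
    |modelPsi m₁ m₂ κ₁ κ₂ t| ≤ 8 * Real.exp (σs * U) * K := by
  have hg : HasSum (fun i ↦ 8 * Real.exp (σs * U) * (m₁ i / (κ₁ i).im ^ 2 + m₂ i / (κ₂ i).im ^ 2))
      (8 * Real.exp (σs * U) * K) := hK.mul_left _
  rw [modelPsi, ← Real.norm_eq_abs]
  refine tsum_of_norm_bounded hg fun i ↦ ?_
  rw [Real.norm_eq_abs]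
  calc |quadTerm (m₁ i) (κ₁ i) t + quadTerm (m₂ i) (κ₂ i) t|
      ≤ |quadTerm (m₁ i) (κ₁ i) t| + |quadTerm (m₂ i) (κ₂ i) t| := abs_add_le _ _
    _ ≤ 8 * Real.exp (σs * U) * (m₁ i / (κ₁ i).im ^ 2) + 8 * Real.exp (σs * U) * (m₂ i / (κ₂ i).im ^ 2) :=
        add_le_add (abs_quadTerm_le_window (hm i).1 (hre i).1 (him i).1 ht)
          (abs_quadTerm_le_window (hm i).2 (hre i).2 (him i).2 ht)
    _ = 8 * Real.exp (σs * U) * (m₁ i / (κ₁ i).im ^ 2 + m₂ i / (κ₂ i).im ^ 2) := by ring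

/-- Budget arithmetic of the dilation: with the scale `λ = 3h²/(4π²M²)` and `36 h² e^{σ*U} A/(π² ε) ≤ M²`,
the window bound `8 e^{σ*U} · 6 λ A` is `≤ ε`. -/
theorem footprint_budget {h ε M A σs U : ℝ} (hε : 0 < ε) (hM : 0 < M)
    (hMQ : 36 * h ^ 2 * Real.exp (σs * U) * A / (π ^ 2 * ε) ≤ M ^ 2) :
    8 * Real.exp (σs * U) * (6 * (3 * h ^ 2 / (4 * π ^ 2 * M ^ 2) * A)) ≤ ε := by
  have hπ := Real.pi_pos
  rw [div_le_iff₀ (by positivity)] at hMQ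
  rw [show 8 * Real.exp (σs * U) * (6 * (3 * h ^ 2 / (4 * π ^ 2 * M ^ 2) * A))
      = (36 * h ^ 2 * Real.exp (σs * U) * A) / (π ^ 2 * M ^ 2) by field_simp; ring]
  rw [div_le_iff₀ (by positivity)]
  calc 36 * h ^ 2 * Real.exp (σs * U) * A ≤ M ^ 2 * (π ^ 2 * ε) := hMQ
    _ = ε * (π ^ 2 * M ^ 2) := by ring

end Summit.RiemannHypothesis.RiemannHypothesis.Theorems.Splittings.ScrewLatticeTower

end
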